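import Literature.NumberTheory.CubicFields.CubicFieldDiscriminant1559
import HarnessLib

/-!
# The cubic field of discriminant `−1559`, II: the primes of norm `≤ 11` and ★ class number ONE — `2 = 𝔭_a𝔭_b𝔭_c` with principal `𝔭`'s generated by
# `-1 − 3θ + 3δ`, `-35 + 17θ − 4δ`, `8 − 4θ + δ` (Dedekind's splitting), the odd primes by Dedekind–Kummer through `θ`

Sequel of `CubicFieldDiscriminant1559.lean` (att-p4 g46, cell `bsd-f1-sign2`).  THEOREMS ONLY.  The Minkowski bound of `F` (`d_F = −1559`, signature `(1,1)`) is
`(4/π)(6/27)√1559 < 12`; the primes above `2` are the three principal primes generated by the norm-`±2` elements above (their product is `2` times a unit; norms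
by the norm form on `1, α, α²`), and every prime of norm `≤ 11` above an odd `p` is principal by Dedekind–Kummer through `θ` (`p ∤ 2 ⊇ [𝓞_F : ℤ[θ]]`) with explicit
generators.  Hence `𝓞_F` is a PID and ★ `h_F = 1` — the datum `2 ∤ h(ℚ(β))` of the split-stratum doors of route `AlignedTransportAtTwo`.
[cite: Marcus2018, Ch. 3, Thm. 27 and Exercise 21; Ch. 5, Thm. 37 and Cor. 2] [cite: LMFDB, number field 3.1.1559.1 (class number 1)]
-/

noncomputable section

open Polynomial NumberField NumberField.InfinitePlace Ideal Module Real
open Literature.NumberTheory.NumberFields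
open Literature.NumberTheory.NumberFields.MonicCubic

namespace Literature.NumberTheory.CubicFields.CubicDisc1559

section NumberField

variable {F : Type*} [Field F] [NumberField F] {α : F}

/-! ## §3 The primes of norm `≤ 11` are principal -/

/-- `p ∤ exponent(θ)` for every prime `p ≠ 2` (Dedekind–Kummer for `f` away from `2`). [cite: Marcus2018, Ch. 3, Thm. 27] -/
theorem not_dvd_exponent (h3 : finrank ℚ F = 3) (hα : aeval α (poly (-7) 14 8) = 0) {p : ℕ} (hp : p.Prime) (hp2 : p ≠ 2) :
    ¬ p ∣ RingOfIntegers.exponent (thetaInt hα) :=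
  MonicCubic.not_dvd_exponent hα (mem2 h3 hα) fun h =>
    hp2 ((Nat.prime_dvd_prime_iff_eq hp (by norm_num : Nat.Prime 2)).mp h)

/-- `N(-1 - 3 * θ + 3 * δ) = 2` (norm form on `1, α, α²`; `δ = (α ^ 2 + α) / 2`). [cite: Marcus2018, Ch. 2, Thm. 4 and Exercise 13] -/
theorem natAbs_norm_piA (h3 : finrank ℚ F = 3) (hα : aeval α (poly (-7) 14 8) = 0) :
    (Algebra.norm ℤ (-1 - 3 * thetaInt hα + 3 * thetaInt (delta_root hα) : 𝓞 F)).natAbs = 2 := by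
  have h : ((Algebra.norm ℤ (-1 - 3 * thetaInt hα + 3 * thetaInt (delta_root hα) : 𝓞 F) : ℤ) : ℚ) = Algebra.norm ℚ (algebraMap (𝓞 F) F (-1 - 3 * thetaInt hα + 3 * thetaInt (delta_root hα))) :=
    Algebra.coe_norm_int _
  have hx : algebraMap (𝓞 F) F (-1 - 3 * thetaInt hα + 3 * thetaInt (delta_root hα)) = ((-1 : ℚ) : F) + ((-3/2 : ℚ) : F) * α + ((3/2 : ℚ) : F) * α ^ 2 := by
    simp only [map_mul, map_add, map_sub, map_neg, map_ofNat, map_one, MonicCubic.thetaInt, RingOfIntegers.map_mk]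
    push_cast; ring
  rw [hx, norm_lin irreducible_polyQ hα h3] at h
  have hn : normForm (-7) 14 8 (-1) (-3/2) (3/2) = ((2 : ℤ) : ℚ) := by norm_num [normForm]
  rw [hn] at h
  have h' : Algebra.norm ℤ (-1 - 3 * thetaInt hα + 3 * thetaInt (delta_root hα) : 𝓞 F) = 2 := by exact_mod_cast h
  rw [h']; rfl

/-- `-1 - 3 * θ + 3 * δ` is a prime element of `𝓞_F` (norm `2`). [cite: Marcus2018, Ch. 3, Thm. 27] -/
theorem prime_piA (h3 : finrank ℚ F = 3) (hα : aeval α (poly (-7) 14 8) = 0) : Prime (-1 - 3 * thetaInt hα + 3 * thetaInt (delta_root hα) : 𝓞 F) :=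
  prime_of_natAbs_norm_prime (by rw [natAbs_norm_piA h3 hα]; norm_num)

/-- `N(-35 + 17 * θ - 4 * δ) = -2` (norm form on `1, α, α²`; `δ = (α ^ 2 + α) / 2`). [cite: Marcus2018, Ch. 2, Thm. 4 and Exercise 13] -/
theorem natAbs_norm_piB (h3 : finrank ℚ F = 3) (hα : aeval α (poly (-7) 14 8) = 0) :
    (Algebra.norm ℤ (-35 + 17 * thetaInt hα - 4 * thetaInt (delta_root hα) : 𝓞 F)).natAbs = 2 := by
  have h : ((Algebra.norm ℤ (-35 + 17 * thetaInt hα - 4 * thetaInt (delta_root hα) : 𝓞 F) : ℤ) : ℚ) = Algebra.norm ℚ (algebraMap (𝓞 F) F (-35 + 17 * thetaInt hα - 4 * thetaInt (delta_root hα))) :=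
    Algebra.coe_norm_int _
  have hx : algebraMap (𝓞 F) F (-35 + 17 * thetaInt hα - 4 * thetaInt (delta_root hα)) = ((-35 : ℚ) : F) + ((15 : ℚ) : F) * α + ((-2 : ℚ) : F) * α ^ 2 := by
    simp only [map_mul, map_add, map_sub, map_neg, map_ofNat, MonicCubic.thetaInt, RingOfIntegers.map_mk]
    push_cast; ring
  rw [hx, norm_lin irreducible_polyQ hα h3] at h
  have hn : normForm (-7) 14 8 (-35) (15) (-2) = ((-2 : ℤ) : ℚ) := by norm_num [normForm]
  rw [hn] at h
  have h' : Algebra.norm ℤ (-35 + 17 * thetaInt hα - 4 * thetaInt (delta_root hα) : 𝓞 F) = -2 := by exact_mod_cast h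
  rw [h']; rfl

/-- `-35 + 17 * θ - 4 * δ` is a prime element of `𝓞_F` (norm `-2`). [cite: Marcus2018, Ch. 3, Thm. 27] -/
theorem prime_piB (h3 : finrank ℚ F = 3) (hα : aeval α (poly (-7) 14 8) = 0) : Prime (-35 + 17 * thetaInt hα - 4 * thetaInt (delta_root hα) : 𝓞 F) :=
  prime_of_natAbs_norm_prime (by rw [natAbs_norm_piB h3 hα]; norm_num)

/-- `N(8 - 4 * θ + δ) = 2` (norm form on `1, α, α²`; `δ = (α ^ 2 + α) / 2`). [cite: Marcus2018, Ch. 2, Thm. 4 and Exercise 13] -/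
theorem natAbs_norm_piC (h3 : finrank ℚ F = 3) (hα : aeval α (poly (-7) 14 8) = 0) :
    (Algebra.norm ℤ (8 - 4 * thetaInt hα + thetaInt (delta_root hα) : 𝓞 F)).natAbs = 2 := by
  have h : ((Algebra.norm ℤ (8 - 4 * thetaInt hα + thetaInt (delta_root hα) : 𝓞 F) : ℤ) : ℚ) = Algebra.norm ℚ (algebraMap (𝓞 F) F (8 - 4 * thetaInt hα + thetaInt (delta_root hα))) :=
    Algebra.coe_norm_int _
  have hx : algebraMap (𝓞 F) F (8 - 4 * thetaInt hα + thetaInt (delta_root hα)) = ((8 : ℚ) : F) + ((-7/2 : ℚ) : F) * α + ((1/2 : ℚ) : F) * α ^ 2 := by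
    simp only [map_mul, map_add, map_sub, map_ofNat, MonicCubic.thetaInt, RingOfIntegers.map_mk]
    push_cast; ring
  rw [hx, norm_lin irreducible_polyQ hα h3] at h
  have hn : normForm (-7) 14 8 (8) (-7/2) (1/2) = ((2 : ℤ) : ℚ) := by norm_num [normForm]
  rw [hn] at h
  have h' : Algebra.norm ℤ (8 - 4 * thetaInt hα + thetaInt (delta_root hα) : 𝓞 F) = 2 := by exact_mod_cast h
  rw [h']; rfl

/-- `8 - 4 * θ + δ` is a prime element of `𝓞_F` (norm `2`). [cite: Marcus2018, Ch. 3, Thm. 27] -/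
theorem prime_piC (h3 : finrank ℚ F = 3) (hα : aeval α (poly (-7) 14 8) = 0) : Prime (8 - 4 * thetaInt hα + thetaInt (delta_root hα) : 𝓞 F) :=
  prime_of_natAbs_norm_prime (by rw [natAbs_norm_piC h3 hα]; norm_num)

/-- **`2` splits completely**: `(-1 - 3 * θ + 3 * δ)·(-35 + 17 * θ - 4 * δ)·(8 - 4 * θ + δ) = (-1)·2` (the cofactor is a unit). [cite: Marcus2018, Ch. 3, Thm. 27 and Exercise 21 (Dedekind)] -/
theorem prod_dyadic_eq (hα : aeval α (poly (-7) 14 8) = 0) :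
    (-1 - 3 * thetaInt hα + 3 * thetaInt (delta_root hα) : 𝓞 F) * (-35 + 17 * thetaInt hα - 4 * thetaInt (delta_root hα)) * (8 - 4 * thetaInt hα + thetaInt (delta_root hα)) = (-1) * (((2 : ℕ) : ℤ) : 𝓞 F) := by
  rw [RingOfIntegers.ext_iff]
  simp only [map_mul, map_add, map_sub, map_neg, map_ofNat, map_one, map_intCast, MonicCubic.thetaInt, RingOfIntegers.map_mk]
  push_cast
  linear_combination (((141 : F) / 4) + ((-79 : F) / 2) * α + ((51 : F) / 4) * α ^ 2 + ((-3 : F) / 2) * α ^ 3) * cubic_eq hα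

/-- **Every prime of `𝓞_F` above `2` is principal**: `2` is the product of the three prime elements above (up to a unit), so a prime `P ∋ 2` is one of
the three principal primes `(π)`. [cite: Marcus2018, Ch. 3, Thm. 27 and Exercise 21] [cite: LMFDB, number field 3.1.1559.1 (class number 1)] -/
theorem isPrincipal_of_mem_primesOver_2 (h3 : finrank ℚ F = 3) (hα : aeval α (poly (-7) 14 8) = 0) {P : Ideal (𝓞 F)}
    (hP : P ∈ primesOver (span {((2 : ℕ) : ℤ)}) (𝓞 F)) : Submodule.IsPrincipal P := by
  haveI := hP.1
  have h2 : (((2 : ℕ) : ℤ) : 𝓞 F) ∈ P := by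
    have hu : ((2 : ℕ) : ℤ) ∈ P.under ℤ := by
      rw [← hP.2.over]; exact Ideal.mem_span_singleton_self _
    exact hu
  have hmem : (-1 - 3 * thetaInt hα + 3 * thetaInt (delta_root hα) : 𝓞 F) * (-35 + 17 * thetaInt hα - 4 * thetaInt (delta_root hα)) * (8 - 4 * thetaInt hα + thetaInt (delta_root hα)) ∈ P := by
    rw [prod_dyadic_eq hα]; exact P.mul_mem_left _ h2
  rcases eq_span_singleton_of_prod_mem hP.1 (prime_piA h3 hα) (prime_piB h3 hα) (prime_piC h3 hα) hmem with h | h | h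
  · exact ⟨⟨_, by rw [h, Ideal.submodule_span_eq]⟩⟩
  · exact ⟨⟨_, by rw [h, Ideal.submodule_span_eq]⟩⟩
  · exact ⟨⟨_, by rw [h, Ideal.submodule_span_eq]⟩⟩

/-- **Every prime of `𝓞_F` above `3` is principal**: `3` is inert (`f` irreducible mod `3`, `3 ∤ exponent`), so `P = (3)`.
[cite: Marcus2018, Ch. 3, Thm. 27] [cite: LMFDB, number field 3.1.1559.1 (class number 1)] -/
theorem isPrincipal_of_mem_primesOver_3 (h3 : finrank ℚ F = 3) (hα : aeval α (poly (-7) 14 8) = 0) {P : Ideal (𝓞 F)}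
    (hP : P ∈ primesOver (span {((3 : ℕ) : ℤ)}) (𝓞 F)) : Submodule.IsPrincipal P := by
  have hPeq := eq_span_of_no_root' irreducible_polyQ hα (by norm_num : Nat.Prime 3)
    (not_dvd_exponent h3 hα (by norm_num) (by norm_num)) hP no_root_3
  exact ⟨⟨((3 : ℕ) : 𝓞 F), by rw [hPeq, Ideal.submodule_span_eq]⟩⟩

/-- `f` has no root modulo `5`. [cite: Marcus2018, Ch. 3, Thm. 27] -/
theorem no_root_5' :
    ∀ r : ZMod 5, r ^ 3 + ((-7 : ℤ) : ZMod 5) * r ^ 2 + ((14 : ℤ) : ZMod 5) * r + ((8 : ℤ) : ZMod 5) ≠ 0 := by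
  decide

/-- **Every prime of `𝓞_F` above `5` is principal**: `5` is inert (`f` irreducible mod `5`, `5 ∤ exponent`), so `P = (5)`.
[cite: Marcus2018, Ch. 3, Thm. 27] [cite: LMFDB, number field 3.1.1559.1 (class number 1)] -/
theorem isPrincipal_of_mem_primesOver_5 (h3 : finrank ℚ F = 3) (hα : aeval α (poly (-7) 14 8) = 0) {P : Ideal (𝓞 F)}
    (hP : P ∈ primesOver (span {((5 : ℕ) : ℤ)}) (𝓞 F)) : Submodule.IsPrincipal P := by
  have hPeq := eq_span_of_no_root' irreducible_polyQ hα (by norm_num : Nat.Prime 5)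
    (not_dvd_exponent h3 hα (by norm_num) (by norm_num)) hP no_root_5'
  exact ⟨⟨((5 : ℕ) : 𝓞 F), by rw [hPeq, Ideal.submodule_span_eq]⟩⟩

/-- `(7, θ + 4) = (1 + 2 * θ)`, an element of norm `7` (identities checked in `F`, `δ = (α ^ 2 + α) / 2`).
[cite: Marcus2018, Ch. 3, Thm. 27] -/
theorem span_7_lin4_eq (hα : aeval α (poly (-7) 14 8) = 0) :
    span {(7 : 𝓞 F), thetaInt hα + 4} = span {1 + 2 * thetaInt hα} := by
  apply le_antisymm
  · rw [span_le]
    rintro x hx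
    rcases hx with rfl | hx
    · exact mem_span_singleton'.mpr ⟨71 - 34 * thetaInt hα + 8 * thetaInt (delta_root hα), by
          rw [RingOfIntegers.ext_iff]
          simp only [map_mul, map_add, map_sub, map_ofNat, map_one, MonicCubic.thetaInt, RingOfIntegers.map_mk]
          linear_combination (((8 : F))) * cubic_eq hα⟩
    · rw [Set.mem_singleton_iff.mp hx]
      exact mem_span_singleton'.mpr ⟨36 - 17 * thetaInt hα + 4 * thetaInt (delta_root hα), by
          rw [RingOfIntegers.ext_iff]
          simp only [map_mul, map_add, map_sub, map_ofNat, map_one, MonicCubic.thetaInt, RingOfIntegers.map_mk]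
          linear_combination (((4 : F))) * cubic_eq hα⟩
  · rw [span_singleton_le_iff_mem, mem_span_pair]
    exact ⟨-1, 2, by
        rw [RingOfIntegers.ext_iff]
        simp only [map_mul, map_add, map_neg, map_ofNat, map_one, MonicCubic.thetaInt, RingOfIntegers.map_mk]
        linear_combination (0 : F) * cubic_eq hα⟩

/-- `(7, θ + 2) = (-3 - 6 * θ - 2 * δ)`, an element of norm `7` (identities checked in `F`, `δ = (α ^ 2 + α) / 2`).
[cite: Marcus2018, Ch. 3, Thm. 27] -/
theorem span_7_lin2_eq (hα : aeval α (poly (-7) 14 8) = 0) :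
    span {(7 : 𝓞 F), thetaInt hα + 2} = span {-3 - 6 * thetaInt hα - 2 * thetaInt (delta_root hα)} := by
  apply le_antisymm
  · rw [span_le]
    rintro x hx
    rcases hx with rfl | hx
    · exact mem_span_singleton'.mpr ⟨1899 - 922 * thetaInt hα + 218 * thetaInt (delta_root hα), by
          rw [RingOfIntegers.ext_iff]
          simp only [map_mul, map_add, map_sub, map_neg, map_ofNat, MonicCubic.thetaInt, RingOfIntegers.map_mk]
          linear_combination (((-713 : F)) + ((-109 : F)) * α) * cubic_eq hα⟩
    · rw [Set.mem_singleton_iff.mp hx]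
      exact mem_span_singleton'.mpr ⟨418 - 203 * thetaInt hα + 48 * thetaInt (delta_root hα), by
          rw [RingOfIntegers.ext_iff]
          simp only [map_mul, map_add, map_sub, map_neg, map_ofNat, MonicCubic.thetaInt, RingOfIntegers.map_mk]
          linear_combination (((-157 : F)) + ((-24 : F)) * α) * cubic_eq hα⟩
  · rw [span_singleton_le_iff_mem, mem_span_pair]
    exact ⟨-3 + 4 * thetaInt (delta_root hα), 9 - 15 * thetaInt hα, by
        rw [RingOfIntegers.ext_iff]
        simp only [map_mul, map_add, map_sub, map_neg, map_ofNat, MonicCubic.thetaInt, RingOfIntegers.map_mk]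
        linear_combination (0 : F) * cubic_eq hα⟩

/-- `(7, θ + 1) = (5 + 12 * θ - 4 * δ)`, an element of norm `-7` (identities checked in `F`, `δ = (α ^ 2 + α) / 2`).
[cite: Marcus2018, Ch. 3, Thm. 27] -/
theorem span_7_lin1_eq (hα : aeval α (poly (-7) 14 8) = 0) :
    span {(7 : 𝓞 F), thetaInt hα + 1} = span {5 + 12 * thetaInt hα - 4 * thetaInt (delta_root hα)} := by
  apply le_antisymm
  · rw [span_le]
    rintro x hx
    rcases hx with rfl | hx
    · exact mem_span_singleton'.mpr ⟨-453 + 220 * thetaInt hα - 52 * thetaInt (delta_root hα), by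
          rw [RingOfIntegers.ext_iff]
          simp only [map_mul, map_add, map_sub, map_neg, map_ofNat, MonicCubic.thetaInt, RingOfIntegers.map_mk]
          linear_combination (((-284 : F)) + ((52 : F)) * α) * cubic_eq hα⟩
    · rw [Set.mem_singleton_iff.mp hx]
      exact mem_span_singleton'.mpr ⟨-35 + 17 * thetaInt hα - 4 * thetaInt (delta_root hα), by
          rw [RingOfIntegers.ext_iff]
          simp only [map_mul, map_add, map_sub, map_neg, map_ofNat, map_one, MonicCubic.thetaInt, RingOfIntegers.map_mk]
          linear_combination (((-22 : F)) + ((4 : F)) * α) * cubic_eq hα⟩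
  · rw [span_singleton_le_iff_mem, mem_span_pair]
    exact ⟨thetaInt hα - 4 * thetaInt (delta_root hα), 5 + 12 * thetaInt hα, by
        rw [RingOfIntegers.ext_iff]
        simp only [map_mul, map_add, map_sub, map_ofNat, map_one, MonicCubic.thetaInt, RingOfIntegers.map_mk]
        linear_combination (0 : F) * cubic_eq hα⟩

/-- **Every prime of `𝓞_F` above `7` is principal** (Dedekind–Kummer through `θ`, `7 ∤ exponent`, with `polyMod_7` and the generators above).
[cite: Marcus2018, Ch. 3, Thm. 27] [cite: LMFDB, number field 3.1.1559.1 (class number 1)] -/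
theorem isPrincipal_of_mem_primesOver_7 (h3 : finrank ℚ F = 3) (hα : aeval α (poly (-7) 14 8) = 0) {P : Ideal (𝓞 F)}
    (hP : P ∈ primesOver (span {((7 : ℕ) : ℤ)}) (𝓞 F)) : Submodule.IsPrincipal P := by
  haveI : Fact (Nat.Prime 7) := ⟨by norm_num⟩
  obtain ⟨Qb, hirr, hmon, hdvd, -, hspan⟩ :=
    exists_factor_of_mem_primesOver' irreducible_polyQ hα (by norm_num : Nat.Prime 7)
      (not_dvd_exponent h3 hα (by norm_num) (by norm_num)) hP
  rw [polyMod_7] at hdvd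
  rcases hirr.prime.dvd_or_dvd hdvd with h12 | h
  · rcases hirr.prime.dvd_or_dvd h12 with h | h
    · have hirr1 : Irreducible (X + 4 : (ZMod 7)[X]) := by
        rw [show (X + 4 : (ZMod 7)[X]) = X - C (-4) by rw [map_neg, map_ofNat]; ring]
        exact irreducible_X_sub_C _
      have hQb : Qb = X + 4 := eq_of_monic_of_associated hmon (by monicity!) (hirr.associated_of_dvd hirr1 h)
      have hPeq := hspan (X + C 4) (by rw [hQb]; simp [map_ofNat])
      rw [show aeval (thetaInt hα) (X + C 4 : ℤ[X]) = thetaInt hα + 4 by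
          simp only [map_add, aeval_X, aeval_C, algebraMap_int_eq, Int.coe_castRingHom, Int.cast_ofNat], Nat.cast_ofNat, span_7_lin4_eq hα] at hPeq
      exact ⟨⟨1 + 2 * thetaInt hα, by rw [hPeq, Ideal.submodule_span_eq]⟩⟩
    · have hirr1 : Irreducible (X + 2 : (ZMod 7)[X]) := by
        rw [show (X + 2 : (ZMod 7)[X]) = X - C (-2) by rw [map_neg, map_ofNat]; ring]
        exact irreducible_X_sub_C _
      have hQb : Qb = X + 2 := eq_of_monic_of_associated hmon (by monicity!) (hirr.associated_of_dvd hirr1 h)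
      have hPeq := hspan (X + C 2) (by rw [hQb]; simp [map_ofNat])
      rw [show aeval (thetaInt hα) (X + C 2 : ℤ[X]) = thetaInt hα + 2 by
          simp only [map_add, aeval_X, aeval_C, algebraMap_int_eq, Int.coe_castRingHom, Int.cast_ofNat], Nat.cast_ofNat, span_7_lin2_eq hα] at hPeq
      exact ⟨⟨-3 - 6 * thetaInt hα - 2 * thetaInt (delta_root hα), by rw [hPeq, Ideal.submodule_span_eq]⟩⟩
  · have hirr1 : Irreducible (X + 1 : (ZMod 7)[X]) := by
      rw [show (X + 1 : (ZMod 7)[X]) = X - C (-1) by rw [map_neg, map_one, sub_neg_eq_add]]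
      exact irreducible_X_sub_C _
    have hQb : Qb = X + 1 := eq_of_monic_of_associated hmon (by monicity!) (hirr.associated_of_dvd hirr1 h)
    have hPeq := hspan (X + 1) (by rw [hQb]; simp)
    rw [show aeval (thetaInt hα) (X + 1 : ℤ[X]) = thetaInt hα + 1 by
        simp only [map_add, aeval_X, map_one], Nat.cast_ofNat, span_7_lin1_eq hα] at hPeq
    exact ⟨⟨5 + 12 * thetaInt hα - 4 * thetaInt (delta_root hα), by rw [hPeq, Ideal.submodule_span_eq]⟩⟩

/-- `f` has no root modulo `11`. [cite: Marcus2018, Ch. 3, Thm. 27] -/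
theorem no_root_11' :
    ∀ r : ZMod 11, r ^ 3 + ((-7 : ℤ) : ZMod 11) * r ^ 2 + ((14 : ℤ) : ZMod 11) * r + ((8 : ℤ) : ZMod 11) ≠ 0 := by
  decide

/-- **Every prime of `𝓞_F` above `11` is principal**: `11` is inert (`f` irreducible mod `11`, `11 ∤ exponent`), so `P = (11)`.
[cite: Marcus2018, Ch. 3, Thm. 27] [cite: LMFDB, number field 3.1.1559.1 (class number 1)] -/
theorem isPrincipal_of_mem_primesOver_11 (h3 : finrank ℚ F = 3) (hα : aeval α (poly (-7) 14 8) = 0) {P : Ideal (𝓞 F)}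
    (hP : P ∈ primesOver (span {((11 : ℕ) : ℤ)}) (𝓞 F)) : Submodule.IsPrincipal P := by
  have hPeq := eq_span_of_no_root' irreducible_polyQ hα (by norm_num : Nat.Prime 11)
    (not_dvd_exponent h3 hα (by norm_num) (by norm_num)) hP no_root_11'
  exact ⟨⟨((11 : ℕ) : 𝓞 F), by rw [hPeq, Ideal.submodule_span_eq]⟩⟩

/-! ## §4 Class number one -/

/-- **`𝓞_F` is a principal ideal domain.**  Minkowski: every ideal class contains an ideal of norm `≤ (4/π)(6/27)√1559 < 12`, and the primes
`P` above `p ≤ 11` with `p^f ≤ 11` are principal (§3). [cite: LMFDB, number field 3.1.1559.1 (class number 1)] [cite: Marcus2018, Ch. 5, Thm. 37 and Cor. 2] -/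
theorem isPrincipalIdealRing (h3 : finrank ℚ F = 3) (hα : aeval α (poly (-7) 14 8) = 0) : IsPrincipalIdealRing (𝓞 F) := by
  apply RingOfIntegers.isPrincipalIdealRing_of_isPrincipal_of_pow_le_of_mem_primesOver_of_mem_Icc
  rw [nrComplexPlaces_eq_one h3 hα, h3, discr_eq h3 hα]
  intro p hp hpr P hP hle
  obtain ⟨hp1, hpM⟩ := Finset.mem_Icc.mp hp
  have hreal : (4 / π) ^ 1 * ((((3 : ℕ).factorial : ℕ) : ℝ) / ((3 : ℕ) : ℝ) ^ (3 : ℕ) * √|((-1559 : ℤ) : ℝ)|) < ((12 : ℕ) : ℝ) := by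
    have hπ := Real.pi_gt_d2
    have hπ0 := Real.pi_pos
    have hs : √(1559 : ℝ) < 39.49 := by
      rw [Real.sqrt_lt' (by norm_num)]; norm_num
    have hs0 : 0 ≤ √(1559 : ℝ) := Real.sqrt_nonneg _
    have habs : |((-1559 : ℤ) : ℝ)| = 1559 := by norm_num
    rw [habs]
    norm_num [Nat.factorial]
    rw [div_mul_eq_mul_div, div_lt_iff₀ hπ0]
    nlinarith
  have hfl := Nat.lt_succ_iff.mp ((Nat.floor_lt' (by norm_num)).mpr hreal)
  have hpB : p ≤ 11 := hpM.trans hfl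
  have hleB : p ^ P.inertiaDeg ℤ ≤ 11 := hle.trans hfl
  clear hpM hle hp
  interval_cases p
  · exact absurd hpr (by norm_num)
  · exact isPrincipal_of_mem_primesOver_2 h3 hα hP
  · exact isPrincipal_of_mem_primesOver_3 h3 hα hP
  · exact absurd hpr (by norm_num)
  · exact isPrincipal_of_mem_primesOver_5 h3 hα hP
  · exact absurd hpr (by norm_num)
  · exact isPrincipal_of_mem_primesOver_7 h3 hα hP
  · exact absurd hpr (by norm_num)
  · exact absurd hpr (by norm_num)
  · exact absurd hpr (by norm_num)
  · exact isPrincipal_of_mem_primesOver_11 h3 hα hP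

/-- ★ **`h_F = 1`: the cubic field of discriminant `−1559` has class number one** (`𝓞_F = ℤ ⊕ ℤθ ⊕ ℤδ`, no power integral basis found).
[cite: LMFDB, number field 3.1.1559.1 (class number 1)] -/
theorem classNumber_eq_one (h3 : finrank ℚ F = 3) (hα : aeval α (poly (-7) 14 8) = 0) : classNumber F = 1 :=
  (classNumber_eq_one_iff (K := F)).mpr (isPrincipalIdealRing h3 hα)

/-- **`h_F` is odd** (the form consumed by the `2`-adic doors of cell `bsd-f1-sign2`). [cite: LMFDB, number field 3.1.1559.1 (class number 1)] -/
theorem not_two_dvd_classNumber (h3 : finrank ℚ F = 3) (hα : aeval α (poly (-7) 14 8) = 0) : ¬ 2 ∣ classNumber F := by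
  rw [classNumber_eq_one h3 hα]; decide

end NumberField

end Literature.NumberTheory.CubicFields.CubicDisc1559

end
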